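import Mathlib.NumberTheory.ModularForms.Bounds
import Mathlib.NumberTheory.ModularForms.CongruenceSubgroups
import Mathlib.NumberTheory.NumberField.Completion.InfinitePlace
import Mathlib.NumberTheory.NumberField.InfiniteAdeleRing
import Literature.NumberTheory.Automorphic.StrongApproximationGL2
import Literature.NumberTheory.Automorphic.AdelicGLnGlue
import Literature.NumberTheory.Automorphic.GLnAdelicStructure
import Literature.NumberTheory.Automorphic.AdelicGroupData
import HarnessLib

/-!
# Adelisation of classical modular forms, I: the archimedean lift and `GL₂(𝔸_ℚ) = GL₂(ℚ) (GL₂(ℝ)⁺ K₁(N))`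

Topic `NumberTheory/Automorphic`; layer E-I of the discharge plan of the adelisation statement
`Literature.NumberTheory.Automorphic.Gelbart1975_exists_adelicNewform` (`Sweep1SymmetricPowerAdelic`, lang.S24). The
dictionary `f ↦ φ_f` from `S_k(Γ₁(N))` to functions on `GL₂(ℚ) \ GL₂(𝔸_ℚ)` (Gelbart (1975), §3.A,
(3.1)–(3.5), Prop. 3.1; Bump (1997), §3.6, (6.1)–(6.3)) writes `g = γ g_∞ k₁` with `γ ∈ GL₂(ℚ)`,
`g_∞ ∈ GL₂(ℝ)⁺`, `k₁ ∈ K₁(N)` and puts `φ_f(g) = f(g_∞ i) j(g_∞, i)^{-k} (det g_∞)^{k/2}`. This file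
provides the two halves of that recipe which do not yet mention `φ_f`:

* **the archimedean lift** `archLift k f : GL₂(ℝ) → ℂ`,
  `archLift k f g = (f ∣[k] g)(i) · |det g|^{(2-k)/2}` (`= f(g i) (det g)^{k/2} j(g, i)^{-k}` for
  `det g > 0`; Gelbart (3.4) with `j(g, z) = (cz + d)(det g)^{-1/2}`, Bump (6.1)/(6.3)), with:
  invariance under `Γ` on the left for `f` slash-invariant of level `Γ` (`archLift_mul_of_mem`),
  invariance under the positive real scalars (`archLift_realScalarGL_mul`; this is why `φ_f` lives
  on the quotient by `A_G = ℝ_{>0}`), the formula `‖archLift k f g‖ = ‖f(g i)‖ Im(g i)^{k/2}`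
  (`norm_archLift_of_det_pos`), boundedness on `GL₂(ℝ)⁺` for cusp forms (`exists_bound_archLift`,
  from Mathlib's bound `‖f τ‖ ≤ C Im(τ)^{-k/2}`, `CuspFormClass.exists_bound`) and continuity on
  `GL₂(ℝ)⁺` (`continuousOn_archLift`);
* **the group theory**: `𝔸_{ℚ,∞} = ℝ` (`Rat.infiniteAdeleRingEquivReal`), the archimedean part
  `Rat.archGL n : GL_n(𝔸_ℚ) →* GL_n(ℝ)`, the embeddings `GLn.ofGlobal` (`= (gl n K).toAdelic`),
  `GLn.ofArch` (`= GLn.ofInfinite ∘ infiniteEquivMixed⁻¹` of `AdelicGLnGlue`), `Rat.ofRealGL`, the open subgroup `Rat.plusLevelOne 𝔫 = GL₂(ℝ)⁺ × K₁(𝔫) ≤ GL₂(𝔸_ℚ)`,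
  the decomposition **`GL₂(𝔸_ℚ) = GL₂(ℚ) · (GL₂(ℝ)⁺ × K₁(𝔫))`**
  (`Rat.exists_ofGlobal_inv_mul_mem_plusLevelOne`, from strong approximation
  `StrongApproximationGL2` and the sign matrix `diag(-1, 1)`; Gelbart (3.1), Bump Thm. 3.3.1),
  the intersection **`GL₂(ℚ) ∩ (GL₂(ℝ)⁺ × K₁(N)) = Γ₁(N)`** (`Rat.ofGlobal_mem_plusLevelOne_iff`;
  Gelbart (3.5)), and `A_G, K(𝔫) ⊆ GL₂(ℝ)⁺ × K₁(𝔫)` (`Rat.posRealScalar_mem_plusLevelOne`,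
  `Rat.principalCongruenceLevel_le_plusLevelOne`).

Everything here is proved; part II (`NewformAdelisationLift`) defines `φ_f` and descends it to the
automorphic quotient `GL₂(𝔸_ℚ) ⧸ A_G GL₂(ℚ)` of the trunk.

## References

* S. Gelbart, *Automorphic forms on adele groups*, Ann. of Math. Stud. 83 (1975), §3.A,
  (3.1)–(3.5), Prop. 3.1 [Gelbart1975].
* D. Bump, *Automorphic forms and representations* (1997), §3.3, Thm. 3.3.1; §3.6, (6.1)–(6.3)
  [Bump1997].
-/

noncomputable section

open Matrix NumberField IsDedekindDomain UpperHalfPlane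
open scoped MatrixGroups ModularForm NNReal

namespace Literature.NumberTheory.Automorphic

section ArchLift

/-- **The archimedean lift** of `f : ℍ → ℂ` in weight `k`:
`archLift k f g = (f ∣[k] g)(i) · (√|det g|)^{2-k}`, i.e. for `det g > 0`,
`f(g i) (det g)^{k-1} j(g, i)^{-k} (√det g)^{2-k} = f(g i) (det g)^{k/2} (c i + d)^{-k}` — Gelbart's
`f(g_∞(i)) j(g_∞, i)^{-k}` in the normalisation `j(g, z) = (cz + d)(det g)^{-1/2}` ((3.4)), Bump's
`F(g_∞)` ((6.1), (6.3)); the factor `(√|det g|)^{2-k}` on top of Mathlib's slash action (which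
carries `|det g|^{k-1}`) makes the lift invariant under the centre `ℝ_{>0}`
(`archLift_realScalarGL_mul`). [cite: Gelbart1975, (3.4)] -/
def archLift (k : ℤ) (f : ℍ → ℂ) (g : GL (Fin 2) ℝ) : ℂ :=
  (f ∣[k] g) UpperHalfPlane.I * ((Real.sqrt |g.det.val| : ℝ) : ℂ) ^ (2 - k)

/-- Unfolding `archLift`. [folklore] -/
theorem archLift_apply (k : ℤ) (f : ℍ → ℂ) (g : GL (Fin 2) ℝ) :
    archLift k f g = (f ∣[k] g) UpperHalfPlane.I * ((Real.sqrt |g.det.val| : ℝ) : ℂ) ^ (2 - k) :=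
  rfl

/-- **Level invariance**: for `f` slash-invariant of weight `k` and level `Γ` with `det Γ = ±1`
and `γ ∈ Γ`, `archLift k f (γ g) = archLift k f g` (`(f|γ)|g = f|g`, `|det(γg)| = |det g|`):
`φ(γ g) = φ(g)`, Gelbart (1975), Prop. 3.1 (i), at the archimedean place. [cite: Gelbart1975, Prop. 3.1] -/
theorem archLift_mul_of_mem {Γ : Subgroup (GL (Fin 2) ℝ)} [Γ.HasDetPlusMinusOne] (k : ℤ)
    {F : Type*} [FunLike F ℍ ℂ] [SlashInvariantFormClass F Γ k] (f : F) {γ : GL (Fin 2) ℝ}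
    (hγ : γ ∈ Γ) (g : GL (Fin 2) ℝ) :
    archLift k f (γ * g) = archLift k f g := by
  rw [archLift_apply, archLift_apply, SlashAction.slash_mul, SlashInvariantForm.slash_action_eqn f γ hγ,
    map_mul, Units.val_mul, abs_mul, Subgroup.HasDetPlusMinusOne.abs_det hγ, one_mul]

/-- The slash action at `g` with `det g > 0`: no complex conjugation and `|det g| = det g`. [folklore] -/
theorem slash_apply_of_det_pos (k : ℤ) (f : ℍ → ℂ) {g : GL (Fin 2) ℝ} (hg : 0 < g.det.val) (τ : ℍ) :
    (f ∣[k] g) τ = f (g • τ) * ((g.det.val : ℝ) : ℂ) ^ (k - 1) * UpperHalfPlane.denom g τ ^ (-k) := by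
  rw [ModularForm.slash_apply, abs_of_pos hg, UpperHalfPlane.σ, if_pos hg]
  rfl

/-- `archLift` at `g` with `det g > 0`:
`f(g i) (det g)^{k-1} j(g, i)^{-k} (√det g)^{2-k}`. [folklore] -/
theorem archLift_apply_of_det_pos (k : ℤ) (f : ℍ → ℂ) {g : GL (Fin 2) ℝ} (hg : 0 < g.det.val) :
    archLift k f g = f (g • UpperHalfPlane.I) * ((g.det.val : ℝ) : ℂ) ^ (k - 1) *
      UpperHalfPlane.denom g UpperHalfPlane.I ^ (-k) * ((Real.sqrt g.det.val : ℝ) : ℂ) ^ (2 - k) := by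
  rw [archLift_apply, slash_apply_of_det_pos k f hg, abs_of_pos hg]

/-- The positive real scalar matrix `r • 1 ∈ GL₂(ℝ)`, `r > 0` (the archimedean part of an
element of `A_G = ℝ_{>0}`). [folklore] -/
def realScalarGL (r : ℝ) (hr : 0 < r) : GL (Fin 2) ℝ :=
  Units.map (algebraMap ℝ (Matrix (Fin 2) (Fin 2) ℝ)).toMonoidHom (Units.mk0 r hr.ne')

/-- The matrix of `realScalarGL r hr` is `r • 1`. [folklore] -/
@[simp]
theorem coe_realScalarGL (r : ℝ) (hr : 0 < r) :
    (realScalarGL r hr : Matrix (Fin 2) (Fin 2) ℝ) = r • (1 : Matrix (Fin 2) (Fin 2) ℝ) := by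
  rw [realScalarGL, Units.coe_map, RingHom.toMonoidHom_eq_coe, MonoidHom.coe_coe, Units.val_mk0,
    Algebra.algebraMap_eq_smul_one]

/-- `det (r • 1) = r²`. [folklore] -/
theorem det_realScalarGL (r : ℝ) (hr : 0 < r) : (realScalarGL r hr).det.val = r ^ 2 := by
  rw [Matrix.GeneralLinearGroup.val_det_apply, coe_realScalarGL, Matrix.det_smul, Matrix.det_one,
    mul_one, Fintype.card_fin]

/-- Entries of `r • 1`. [folklore] -/
theorem realScalarGL_apply (r : ℝ) (hr : 0 < r) (i j : Fin 2) :
    (realScalarGL r hr : Matrix (Fin 2) (Fin 2) ℝ) i j = if i = j then r else 0 := by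
  rw [coe_realScalarGL, Matrix.smul_apply, Matrix.one_apply, smul_eq_mul, mul_ite, mul_one, mul_zero]

/-- Entries of `(r • 1) g`: `r` times those of `g`. [folklore] -/
theorem realScalarGL_mul_apply (r : ℝ) (hr : 0 < r) (g : GL (Fin 2) ℝ) (i j : Fin 2) :
    ((realScalarGL r hr * g : GL (Fin 2) ℝ) : Matrix (Fin 2) (Fin 2) ℝ) i j =
      r * (g : Matrix (Fin 2) (Fin 2) ℝ) i j := by
  rw [Units.val_mul, coe_realScalarGL, Matrix.smul_mul, Matrix.one_mul, Matrix.smul_apply, smul_eq_mul]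

/-- `j((r • 1) g, τ) = r j(g, τ)`. [folklore] -/
theorem denom_realScalarGL_mul (r : ℝ) (hr : 0 < r) (g : GL (Fin 2) ℝ) (τ : ℍ) :
    UpperHalfPlane.denom (realScalarGL r hr * g) τ = r * UpperHalfPlane.denom g τ := by
  simp only [UpperHalfPlane.denom, realScalarGL_mul_apply, Complex.ofReal_mul]
  ring

/-- The numerator of the Möbius transformation of `(r • 1) g` is `r` times that of `g`. [folklore] -/
theorem num_realScalarGL_mul (r : ℝ) (hr : 0 < r) (g : GL (Fin 2) ℝ) (τ : ℍ) :
    UpperHalfPlane.num (realScalarGL r hr * g) τ = r * UpperHalfPlane.num g τ := by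
  simp only [UpperHalfPlane.num, realScalarGL_mul_apply, Complex.ofReal_mul]
  ring

/-- `(r • 1) g` acts on `ℍ` as `g` does (`det g > 0`). [folklore] -/
theorem realScalarGL_mul_smul (r : ℝ) (hr : 0 < r) {g : GL (Fin 2) ℝ} (hg : 0 < g.det.val) (τ : ℍ) :
    (realScalarGL r hr * g) • τ = g • τ := by
  have hdet : 0 < (realScalarGL r hr * g).det.val := by
    rw [map_mul, Units.val_mul, det_realScalarGL]
    positivity
  ext1
  have hr' : ((r : ℝ) : ℂ) ≠ 0 := by exact_mod_cast hr.ne'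
  rw [UpperHalfPlane.coe_smul_of_det_pos hdet, UpperHalfPlane.coe_smul_of_det_pos hg,
    num_realScalarGL_mul, denom_realScalarGL_mul, mul_div_mul_left _ _ hr']

/-- **Central invariance**: `archLift k f ((r • 1) g) = archLift k f g` for `r > 0`, `det g > 0`
— the factor `(r²)^{k-1} r^{-k}` of the slash action cancels against `(√(r² det g))^{2-k}`
(Gelbart (1975), Prop. 3.1 (v) with `ψ` trivial on `ℝ₊ˣ`; Bump (1997), (6.4): the central
character of `φ` is trivial on `ℝ_{>0}`). [cite: Gelbart1975, Prop. 3.1] -/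
theorem archLift_realScalarGL_mul (k : ℤ) (f : ℍ → ℂ) {r : ℝ} (hr : 0 < r) {g : GL (Fin 2) ℝ}
    (hg : 0 < g.det.val) : archLift k f (realScalarGL r hr * g) = archLift k f g := by
  have hdet : (realScalarGL r hr * g).det.val = r ^ 2 * g.det.val := by
    rw [map_mul, Units.val_mul, det_realScalarGL]
  have hdet' : 0 < (realScalarGL r hr * g).det.val := by rw [hdet]; positivity
  rw [archLift_apply_of_det_pos k f hdet', archLift_apply_of_det_pos k f hg,
    realScalarGL_mul_smul r hr hg, denom_realScalarGL_mul, hdet,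
    Real.sqrt_mul' _ hg.le, Real.sqrt_sq hr.le, Complex.ofReal_mul, Complex.ofReal_mul,
    Complex.ofReal_pow, mul_zpow, mul_zpow, mul_zpow]
  have hr' : ((r : ℝ) : ℂ) ≠ 0 := by exact_mod_cast hr.ne'
  -- collect the powers of `r`: `(r²)^(k-1) · r^(-k) · r^(2-k) = 1`
  have key : ((r : ℂ) ^ 2) ^ (k - 1) * (r : ℂ) ^ (-k) * (r : ℂ) ^ (2 - k) = 1 := by
    rw [← zpow_natCast, ← _root_.zpow_mul, ← zpow_add₀ hr', ← zpow_add₀ hr']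
    have : ((2 : ℕ) : ℤ) * (k - 1) + -k + (2 - k) = 0 := by push_cast; ring
    rw [this, zpow_zero]
  calc f (g • UpperHalfPlane.I) * (((r : ℂ) ^ 2) ^ (k - 1) * ((g.det.val : ℝ) : ℂ) ^ (k - 1)) *
        ((r : ℂ) ^ (-k) * UpperHalfPlane.denom g UpperHalfPlane.I ^ (-k)) *
        ((r : ℂ) ^ (2 - k) * ((Real.sqrt g.det.val : ℝ) : ℂ) ^ (2 - k))
      = (((r : ℂ) ^ 2) ^ (k - 1) * (r : ℂ) ^ (-k) * (r : ℂ) ^ (2 - k)) *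
          (f (g • UpperHalfPlane.I) * ((g.det.val : ℝ) : ℂ) ^ (k - 1) *
            UpperHalfPlane.denom g UpperHalfPlane.I ^ (-k) * ((Real.sqrt g.det.val : ℝ) : ℂ) ^ (2 - k)) := by
        ring
    _ = _ := by rw [key, one_mul]

/-- For `s, d > 0`: `(s²)^(k-1) d^(-k) s^(2-k) = (s/d)^k` (the exponent bookkeeping of
`norm_archLift_of_det_pos`). [folklore] -/
theorem sq_zpow_mul_zpow_neg_mul_zpow {s : ℝ} (d : ℝ) (hs : 0 < s) (k : ℤ) :
    (s ^ 2) ^ (k - 1) * d ^ (-k) * s ^ (2 - k) = (s / d) ^ k := by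
  rw [div_zpow, _root_.zpow_neg, div_eq_mul_inv, ← zpow_natCast, ← _root_.zpow_mul]
  have h1 : s ^ ((2 : ℕ) * (k - 1)) * s ^ (2 - k) = s ^ k := by
    rw [← zpow_add₀ hs.ne']
    congr 1
    push_cast
    ring
  calc s ^ ((2 : ℕ) * (k - 1)) * (d ^ k)⁻¹ * s ^ (2 - k)
      = s ^ ((2 : ℕ) * (k - 1)) * s ^ (2 - k) * (d ^ k)⁻¹ := by ring
    _ = s ^ k * (d ^ k)⁻¹ := by rw [h1]

/-- `|archLift k f g| = |f(g i)| Im(g i)^{k/2}` for `det g > 0`, in the form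
`‖archLift k f g‖ = ‖f (g • i)‖ * (√ Im(g • i))^k` (`Im(g i) = det g / |j(g,i)|²`). [folklore] -/
theorem norm_archLift_of_det_pos (k : ℤ) (f : ℍ → ℂ) {g : GL (Fin 2) ℝ} (hg : 0 < g.det.val) :
    ‖archLift k f g‖ = ‖f (g • UpperHalfPlane.I)‖ * Real.sqrt ((g • UpperHalfPlane.I).im) ^ k := by
  have hden : UpperHalfPlane.denom g UpperHalfPlane.I ≠ 0 := UpperHalfPlane.denom_ne_zero g _
  have hden' : 0 < ‖UpperHalfPlane.denom g UpperHalfPlane.I‖ := norm_pos_iff.2 hden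
  have hs : 0 < Real.sqrt g.det.val := Real.sqrt_pos.2 hg
  have him : (g • UpperHalfPlane.I).im = g.det.val / ‖UpperHalfPlane.denom g UpperHalfPlane.I‖ ^ 2 := by
    rw [UpperHalfPlane.im_smul_eq_div_normSq, abs_of_pos hg, UpperHalfPlane.I_im, mul_one,
      Complex.normSq_eq_norm_sq]
  have hsqrt : Real.sqrt ((g • UpperHalfPlane.I).im) =
      Real.sqrt g.det.val / ‖UpperHalfPlane.denom g UpperHalfPlane.I‖ := by
    rw [him, Real.sqrt_div' _ (sq_nonneg _), Real.sqrt_sq hden'.le]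
  have hsq : (g.det.val : ℝ) = Real.sqrt g.det.val ^ 2 := (Real.sq_sqrt hg.le).symm
  rw [archLift_apply_of_det_pos k f hg, norm_mul, norm_mul, norm_mul, norm_zpow, norm_zpow, norm_zpow,
    Complex.norm_real, Complex.norm_real, Real.norm_of_nonneg hg.le,
    Real.norm_of_nonneg (Real.sqrt_nonneg _), hsqrt, ← sq_zpow_mul_zpow_neg_mul_zpow _ hs k, ← hsq]
  ring

/-- **Boundedness of the archimedean lift of a cusp form on `GL₂(ℝ)⁺`**: with `τ = g i`,
`|archLift k f g| = |f(τ)| Im(τ)^{k/2} ≤ C` (Mathlib `CuspFormClass.exists_bound`: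
`‖f τ‖ ≤ C / Im(τ)^{k/2}` for cusp forms of arithmetic level; Gelbart (1975), §3.A, p. 28
(`φ_f` is bounded on `G_𝔸`, being `|f(z)| y^{k/2}` on a fundamental domain); Bump (1997), §3.6).
[cite: Gelbart1975, §3.A, p. 28] -/
theorem exists_bound_archLift {k : ℤ} {Γ : Subgroup (GL (Fin 2) ℝ)} [Γ.IsArithmetic]
    {F : Type*} [FunLike F ℍ ℂ] [CuspFormClass F Γ k] (f : F) :
    ∃ C : ℝ, ∀ g : GL (Fin 2) ℝ, 0 < g.det.val → ‖archLift k f g‖ ≤ C := by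
  obtain ⟨C, hC⟩ := CuspFormClass.exists_bound f
  refine ⟨C, fun g hg => ?_⟩
  rw [norm_archLift_of_det_pos k f hg]
  set τ := g • UpperHalfPlane.I with hτ
  have him : 0 < τ.im := τ.im_pos
  have hpow : Real.sqrt τ.im ^ k = τ.im ^ ((k : ℝ) / 2) := by
    rw [Real.sqrt_eq_rpow, ← Real.rpow_intCast, ← Real.rpow_mul him.le]
    congr 1
    ring
  rw [hpow]
  have hpos : 0 < τ.im ^ ((k : ℝ) / 2) := Real.rpow_pos_of_pos him _
  calc ‖f τ‖ * τ.im ^ ((k : ℝ) / 2) ≤ C / τ.im ^ ((k : ℝ) / 2) * τ.im ^ ((k : ℝ) / 2) := by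
        gcongr
        exact hC τ
    _ = C := div_mul_cancel₀ C hpos.ne'

/-- **Continuity of the archimedean lift on `GL₂(ℝ)⁺`** for continuous `f` (e.g. a modular
form): `g ↦ g i = (a i + b)/(c i + d)`, `det g` and `j(g, i) = c i + d` are continuous in the
entries of `g`. [folklore] -/
theorem continuousOn_archLift (k : ℤ) {f : ℍ → ℂ} (hf : Continuous f) :
    ContinuousOn (archLift k f) {g : GL (Fin 2) ℝ | 0 < g.det.val} := by
  have hent : ∀ i j : Fin 2, Continuous fun g : GL (Fin 2) ℝ => (g : Matrix (Fin 2) (Fin 2) ℝ) i j :=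
    fun i j => Units.continuous_val.matrix_elem i j
  have hnum : Continuous fun g : GL (Fin 2) ℝ => UpperHalfPlane.num g UpperHalfPlane.I := by
    simp only [UpperHalfPlane.num]
    exact ((Complex.continuous_ofReal.comp (hent 0 0)).mul continuous_const).add
      (Complex.continuous_ofReal.comp (hent 0 1))
  have hdenom : Continuous fun g : GL (Fin 2) ℝ => UpperHalfPlane.denom g UpperHalfPlane.I := by
    simp only [UpperHalfPlane.denom]
    exact ((Complex.continuous_ofReal.comp (hent 1 0)).mul continuous_const).add
      (Complex.continuous_ofReal.comp (hent 1 1))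
  have hdet : Continuous fun g : GL (Fin 2) ℝ => (g.det.val : ℝ) :=
    Units.continuous_val.comp Matrix.GeneralLinearGroup.continuous_det
  have h1 : ContinuousOn (fun g : GL (Fin 2) ℝ => ((g • UpperHalfPlane.I : ℍ) : ℂ))
      {g : GL (Fin 2) ℝ | 0 < g.det.val} := by
    refine (hnum.div hdenom fun g => UpperHalfPlane.denom_ne_zero g _).continuousOn.congr ?_
    intro g hg
    exact UpperHalfPlane.coe_smul_of_det_pos hg _
  have h2 : ContinuousOn (fun g : GL (Fin 2) ℝ => g • UpperHalfPlane.I)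
      {g : GL (Fin 2) ℝ | 0 < g.det.val} :=
    UpperHalfPlane.isEmbedding_coe.isInducing.continuousOn_iff.2 h1
  have h3 : ContinuousOn (fun g : GL (Fin 2) ℝ => f (g • UpperHalfPlane.I))
      {g : GL (Fin 2) ℝ | 0 < g.det.val} := hf.comp_continuousOn h2
  have h4 : ContinuousOn (fun g : GL (Fin 2) ℝ => f (g • UpperHalfPlane.I) *
      ((g.det.val : ℝ) : ℂ) ^ (k - 1) * UpperHalfPlane.denom g UpperHalfPlane.I ^ (-k) *
      ((Real.sqrt g.det.val : ℝ) : ℂ) ^ (2 - k)) {g : GL (Fin 2) ℝ | 0 < g.det.val} := by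
    refine ((h3.mul ?_).mul ?_).mul ?_
    · refine ((Complex.continuous_ofReal.comp hdet).continuousOn.zpow₀ _ fun g hg => Or.inl ?_)
      have hg' : (0 : ℝ) < g.det.val := hg
      simp only [Function.comp_apply, ne_eq, Complex.ofReal_eq_zero]
      exact hg'.ne'
    · exact (hdenom.continuousOn.zpow₀ _ fun g _ => Or.inl (UpperHalfPlane.denom_ne_zero g _))
    · refine ((Complex.continuous_ofReal.comp (Real.continuous_sqrt.comp hdet)).continuousOn.zpow₀ _
        fun g hg => Or.inl ?_)
      have hg' : (0 : ℝ) < g.det.val := hg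
      simp only [Function.comp_apply, ne_eq, Complex.ofReal_eq_zero]
      exact (Real.sqrt_pos.2 hg').ne'
  exact h4.congr fun g hg => archLift_apply_of_det_pos k f hg

end ArchLift

/-! ### The archimedean place of `ℚ`: `ℚ_∞ = ℝ` -/

section RatArch

/-- The (unique) infinite place of `ℚ` is real. [folklore] -/
theorem Rat.isReal_default_infinitePlace : (default : InfinitePlace ℚ).IsReal :=
  Rat.isReal_infinitePlace

/-- **`𝔸_{ℚ,∞} = ℝ`**: the infinite adele ring of `ℚ` is the completion at its unique (real)
infinite place, identified with `ℝ` (Mathlib `RingEquiv.piUnique`, `Unique (InfinitePlace ℚ)`,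
`Completion.ringEquivRealOfIsReal`). [folklore] -/
def Rat.infiniteAdeleRingEquivReal : InfiniteAdeleRing ℚ ≃+* ℝ :=
  (RingEquiv.piUnique fun v : InfinitePlace ℚ => v.Completion).trans
    (InfinitePlace.Completion.ringEquivRealOfIsReal Rat.isReal_default_infinitePlace)

/-- Unfolding: `Rat.infiniteAdeleRingEquivReal x` is the real embedding of the component of `x`
at the (default) infinite place. [folklore] -/
theorem Rat.infiniteAdeleRingEquivReal_apply (x : InfiniteAdeleRing ℚ) :
    Rat.infiniteAdeleRingEquivReal x =
      InfinitePlace.Completion.extensionEmbeddingOfIsReal Rat.isReal_default_infinitePlace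
        (x default) :=
  rfl

/-- `Rat.infiniteAdeleRingEquivReal` is continuous (the real embedding of `ℚ_∞` is an isometry). [folklore] -/
theorem Rat.continuous_infiniteAdeleRingEquivReal : Continuous Rat.infiniteAdeleRingEquivReal :=
  (InfinitePlace.Completion.isometryEquivRealOfIsReal Rat.isReal_default_infinitePlace).continuous.comp
    (continuous_apply default)

/-- The inverse of `Rat.infiniteAdeleRingEquivReal` is continuous. [folklore] -/
theorem Rat.continuous_infiniteAdeleRingEquivReal_symm :
    Continuous Rat.infiniteAdeleRingEquivReal.symm := by
  refine continuous_pi fun v => ?_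
  have hv : v = default := Subsingleton.elim _ _
  subst hv
  have : (fun a : ℝ => Rat.infiniteAdeleRingEquivReal.symm a default) =
      (InfinitePlace.Completion.isometryEquivRealOfIsReal Rat.isReal_default_infinitePlace).symm := by
    funext a
    apply (InfinitePlace.Completion.ringEquivRealOfIsReal Rat.isReal_default_infinitePlace).injective
    change Rat.infiniteAdeleRingEquivReal (Rat.infiniteAdeleRingEquivReal.symm a) = _
    rw [RingEquiv.apply_symm_apply]
    exact ((InfinitePlace.Completion.isometryEquivRealOfIsReal
      Rat.isReal_default_infinitePlace).apply_symm_apply a).symm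
  rw [this]
  exact (InfinitePlace.Completion.isometryEquivRealOfIsReal Rat.isReal_default_infinitePlace).symm.continuous

/-- On the diagonal image of `ℚ`, `Rat.infiniteAdeleRingEquivReal` is the inclusion `ℚ ⊆ ℝ`. [folklore] -/
@[simp]
theorem Rat.infiniteAdeleRingEquivReal_algebraMap (q : ℚ) :
    Rat.infiniteAdeleRingEquivReal (algebraMap ℚ (InfiniteAdeleRing ℚ) q) = q := by
  rw [Rat.infiniteAdeleRingEquivReal_apply, InfiniteAdeleRing.algebraMap_apply]
  simp

/-- On the real scalars `realToInfiniteAdele ℚ t` (the archimedean part of `A_G`),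
`Rat.infiniteAdeleRingEquivReal` is the identity of `ℝ`. [folklore] -/
@[simp]
theorem Rat.infiniteAdeleRingEquivReal_realToInfiniteAdele (t : ℝ) :
    Rat.infiniteAdeleRingEquivReal (realToInfiniteAdele ℚ t) = t := by
  rw [Rat.infiniteAdeleRingEquivReal_apply]
  have h : (InfiniteAdeleRing.ringEquiv_mixedSpace ℚ (realToInfiniteAdele ℚ t)).1
      ⟨default, Rat.isReal_default_infinitePlace⟩ = t := by
    rw [realToInfiniteAdele]
    simp only [RingHom.coe_comp, RingEquiv.toRingHom_eq_coe, RingHom.coe_coe, Function.comp_apply,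
      RingEquiv.apply_symm_apply]
    rfl
  simpa only [InfiniteAdeleRing.ringEquiv_mixedSpace_apply] using h

end RatArch

/-! ### Archimedean and finite parts of `GL₂(𝔸_ℚ)` -/

section ArchPart

/-- The diagonal embedding `GL_n(K) →* GL_n(𝔸_K)` of the global points (Mathlib
`GeneralLinearGroup.map` of `algebraMap K 𝔸_K`). This is `(AdelicGroupData.gl n K).toAdelic`
(`AdelicGroupData.gl_toAdelic`, definitional) and its range is the arithmetic subgroup
(`AdelicGroupData.gl_arithmeticSubgroup`); it is given a name whose values have the syntactic type
`GL (Fin n) (AdeleRing (𝓞 K) K)` (rather than `(gl n K).Adelic`), so that Mathlib's `GL_n` lemmas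
and instances apply to them without unfolding. [folklore] -/
abbrev GLn.ofGlobal (n : ℕ) (K : Type*) [Field K] [NumberField K] :
    GL (Fin n) K →* GL (Fin n) (AdeleRing (𝓞 K) K) :=
  Matrix.GeneralLinearGroup.map (algebraMap K (AdeleRing (𝓞 K) K))

/-- `(gl n K).toAdelic` is the diagonal embedding `GLn.ofGlobal n K` (definitional). [folklore] -/
theorem AdelicGroupData.gl_toAdelic (n : ℕ) (K : Type) [Field K] [NumberField K] :
    (AdelicGroupData.gl n K).toAdelic = GLn.ofGlobal n K :=
  rfl

/-- The arithmetic subgroup `GL_n(K) ≤ GL_n(𝔸_K)` of the datum `gl n K` is the range of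
`GLn.ofGlobal n K` (definitional). [folklore] -/
theorem AdelicGroupData.gl_arithmeticSubgroup (n : ℕ) (K : Type) [Field K] [NumberField K] :
    (AdelicGroupData.gl n K).arithmeticSubgroup = (GLn.ofGlobal n K).range :=
  rfl

/-- The **archimedean part** `GL_n(𝔸_ℚ) →* GL_n(ℝ)`: the projection to `GL_n(𝔸_{ℚ,∞})` followed by
`𝔸_{ℚ,∞} = ℝ` (`Rat.infiniteAdeleRingEquivReal`); `g ↦ g_∞` of Gelbart (1975), §3.A and Bump
(1997), §3.6. [folklore] -/
def Rat.archGL (n : ℕ) : GL (Fin n) (AdeleRing (𝓞 ℚ) ℚ) →* GL (Fin n) ℝ :=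
  (Matrix.GeneralLinearGroup.map Rat.infiniteAdeleRingEquivReal.toRingHom).comp (GLn.fstHom n ℚ)

/-- Entries of the archimedean part. [folklore] -/
theorem Rat.archGL_apply (n : ℕ) (g : GL (Fin n) (AdeleRing (𝓞 ℚ) ℚ)) (i j : Fin n) :
    (Rat.archGL n g : Matrix (Fin n) (Fin n) ℝ) i j =
      Rat.infiniteAdeleRingEquivReal (((g : Matrix (Fin n) (Fin n) (AdeleRing (𝓞 ℚ) ℚ)) i j).1) :=
  rfl

/-- The archimedean part is continuous. [folklore] -/
theorem Rat.continuous_archGL (n : ℕ) : Continuous (Rat.archGL n) := by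
  have h1 : Continuous (Rat.infiniteAdeleRingEquivReal.toRingHom : InfiniteAdeleRing ℚ → ℝ) :=
    Rat.continuous_infiniteAdeleRingEquivReal
  have h2 : Continuous (RingHom.fst (InfiniteAdeleRing ℚ) (FiniteAdeleRing (𝓞 ℚ) ℚ)) := continuous_fst
  exact h1.generalLinearGroup_map.comp h2.generalLinearGroup_map

/-- The archimedean component of a principal adele is the diagonal image in `K_∞`
(definitional for Mathlib's `AdeleRing = InfiniteAdeleRing × FiniteAdeleRing`). [folklore] -/
theorem algebraMap_adeleRing_fst (K : Type*) [Field K] [NumberField K] (q : K) :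
    (algebraMap K (AdeleRing (𝓞 K) K) q).1 = algebraMap K (InfiniteAdeleRing K) q :=
  rfl

/-- The finite component of a principal adele is the diagonal image in `𝔸_K^∞` (definitional). [folklore] -/
theorem algebraMap_adeleRing_snd (K : Type*) [Field K] [NumberField K] (q : K) :
    (algebraMap K (AdeleRing (𝓞 K) K) q).2 = algebraMap K (FiniteAdeleRing (𝓞 K) K) q :=
  rfl

/-- The archimedean part of a diagonally embedded `γ ∈ GL_n(ℚ)` is `γ` viewed in `GL_n(ℝ)`. [folklore] -/
@[simp]
theorem Rat.archGL_ofGlobal (n : ℕ) (γ : GL (Fin n) ℚ) :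
    Rat.archGL n (GLn.ofGlobal n ℚ γ) = Matrix.GeneralLinearGroup.map (Rat.castHom ℝ) γ := by
  ext i j
  rw [Rat.archGL_apply, Matrix.GeneralLinearGroup.map_apply, algebraMap_adeleRing_fst,
    Rat.infiniteAdeleRingEquivReal_algebraMap, Matrix.GeneralLinearGroup.map_apply, Rat.coe_castHom]

/-- The finite part of a diagonally embedded `γ ∈ GL_n(ℚ)` is its diagonal image in `GL_n(𝔸_ℚ^∞)`. [folklore] -/
@[simp]
theorem Rat.sndHom_ofGlobal (n : ℕ) (γ : GL (Fin n) ℚ) :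
    GLn.sndHom n ℚ (GLn.ofGlobal n ℚ γ) =
      Matrix.GeneralLinearGroup.map (algebraMap ℚ (FiniteAdeleRing (𝓞 ℚ) ℚ)) γ := by
  ext i j
  rfl

/-- The archimedean part of the central element `posRealScalar n ℚ t ∈ A_G` is the real scalar
matrix `t • 1`. [folklore] -/
theorem Rat.archGL_posRealScalar (n : ℕ) (t : ℝ≥0ˣ) (i j : Fin n) :
    (Rat.archGL n (posRealScalar n ℚ t) : Matrix (Fin n) (Fin n) ℝ) i j =
      if i = j then ((t : ℝ≥0) : ℝ) else 0 := by
  rw [Rat.archGL_apply, posRealScalar, MonoidHom.comp_apply]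
  change Rat.infiniteAdeleRingEquivReal
    ((Matrix.diagonal (fun _ : Fin n => ((posRealIdele ℚ t : (AdeleRing (𝓞 ℚ) ℚ)ˣ) :
      AdeleRing (𝓞 ℚ) ℚ)) i j).1) = _
  rw [Matrix.diagonal_apply]
  split_ifs with h
  · rw [posRealIdele_fst, Rat.infiniteAdeleRingEquivReal_realToInfiniteAdele]
  · exact map_zero _

/-- The finite part of the central element `posRealScalar n ℚ t ∈ A_G` is trivial. [folklore] -/
@[simp]
theorem Rat.sndHom_posRealScalar (n : ℕ) (t : ℝ≥0ˣ) : GLn.sndHom n ℚ (posRealScalar n ℚ t) = 1 := by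
  refine Matrix.GeneralLinearGroup.ext fun i j => ?_
  change ((Matrix.diagonal (fun _ : Fin n => ((posRealIdele ℚ t : (AdeleRing (𝓞 ℚ) ℚ)ˣ) :
      AdeleRing (𝓞 ℚ) ℚ)) i j).2) = (1 : Matrix (Fin n) (Fin n) (FiniteAdeleRing (𝓞 ℚ) ℚ)) i j
  rw [Matrix.diagonal_apply, Matrix.one_apply]
  split_ifs with h
  · rw [posRealIdele_snd]
  · rfl

end ArchPart

/-! ### The open subgroup `GL₂(ℝ)⁺ × K₁(𝔫)` and the decomposition `GL₂(𝔸_ℚ) = GL₂(ℚ) (GL₂(ℝ)⁺ × K₁(𝔫))` -/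

section PlusLevel

/-- The subgroup **`GL₂(ℝ)⁺ × K₁(𝔫) ≤ GL₂(𝔸_ℚ)`**: adelic matrices whose archimedean part has positive
determinant and whose finite part lies in `K₁(𝔫)` (`gammaOneFiniteLevel`); the group
`G_∞⁺ K₁(N)` with `G_𝔸 = G_ℚ G_∞⁺ K₁(N)` and `G_ℚ ∩ G_∞⁺ K₁(N) = Γ₁(N)` of Gelbart (1975), (3.1),
(3.5) (there for `K₀`/`Γ₀`) and Bump (1997), §3.6. [cite: Gelbart1975, (3.1)] -/
def Rat.plusLevelOne (𝔫 : Ideal (𝓞 ℚ)) : Subgroup (GL (Fin 2) (AdeleRing (𝓞 ℚ) ℚ)) :=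
  (Matrix.GLPos (Fin 2) ℝ).comap (Rat.archGL 2) ⊓ (gammaOneFiniteLevel ℚ 𝔫).comap (GLn.sndHom 2 ℚ)

/-- Membership in `GL₂(ℝ)⁺ × K₁(𝔫)`. [folklore] -/
theorem Rat.mem_plusLevelOne_iff {𝔫 : Ideal (𝓞 ℚ)} {g : GL (Fin 2) (AdeleRing (𝓞 ℚ) ℚ)} :
    g ∈ Rat.plusLevelOne 𝔫 ↔
      0 < (Rat.archGL 2 g).det.val ∧ GLn.sndHom 2 ℚ g ∈ gammaOneFiniteLevel ℚ 𝔫 := by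
  rw [Rat.plusLevelOne, Subgroup.mem_inf, Subgroup.mem_comap, Subgroup.mem_comap, Matrix.mem_glpos]

/-- `GL₂(ℝ)⁺ × K₁(𝔫)` is open in `GL₂(𝔸_ℚ)`. [folklore] -/
theorem Rat.isOpen_plusLevelOne (𝔫 : Ideal (𝓞 ℚ)) :
    IsOpen (Rat.plusLevelOne 𝔫 : Set (GL (Fin 2) (AdeleRing (𝓞 ℚ) ℚ))) := by
  have h1 : IsOpen ((Matrix.GLPos (Fin 2) ℝ : Set (GL (Fin 2) ℝ))) := by
    have : (Matrix.GLPos (Fin 2) ℝ : Set (GL (Fin 2) ℝ)) = {g | 0 < g.det.val} := by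
      ext g
      exact Matrix.mem_glpos g
    rw [this]
    exact isOpen_lt continuous_const (Units.continuous_val.comp Matrix.GeneralLinearGroup.continuous_det)
  have h2 : Continuous (GLn.sndHom 2 ℚ) :=
    Continuous.generalLinearGroup_map (f := RingHom.snd (InfiniteAdeleRing ℚ) (FiniteAdeleRing (𝓞 ℚ) ℚ))
      continuous_snd
  exact (h1.preimage (Rat.continuous_archGL 2)).inter ((isOpen_gammaOneFiniteLevel 𝔫).preimage h2)

/-- The **sign matrix** `ε = diag(-1, 1) ∈ GL₂(ℚ)`: `det ε = -1` and `ε ∈ K₁(𝔫)` at the finite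
places, so left multiplication by `ε` switches between the two components `GL₂(ℝ)^±` without
leaving `GL₂(ℚ) K₁(𝔫)` (Gelbart (1975), (3.1): `G_𝔸 = G_ℚ G_∞⁺ K`, using `det K = ∏ ℤ_pˣ` and an
element of `G_ℚ` of negative determinant). [folklore] -/
def Rat.signGL : GL (Fin 2) ℚ := glDiagonal 2 ℚ ![-1, 1]

/-- `det(archimedean part of ε) = -1 < 0`. [folklore] -/
theorem Rat.det_archGL_signGL :
    (Rat.archGL 2 (GLn.ofGlobal 2 ℚ Rat.signGL)).det.val = -1 := by
  rw [Rat.archGL_ofGlobal, Rat.signGL, map_glDiagonal, det_glDiagonal_eq_prod, Fin.prod_univ_two]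
  simp

/-- The finite part of `ε` lies in `K₁(𝔫)` (`glDiagonal_mem_gammaOneFiniteLevel` with `u = -1`). [folklore] -/
theorem Rat.sndHom_signGL_mem (𝔫 : Ideal (𝓞 ℚ)) :
    GLn.sndHom 2 ℚ (GLn.ofGlobal 2 ℚ Rat.signGL) ∈ gammaOneFiniteLevel ℚ 𝔫 := by
  rw [Rat.sndHom_ofGlobal, Rat.signGL, map_glDiagonal]
  have h : (fun i => Units.map (algebraMap ℚ (FiniteAdeleRing (𝓞 ℚ) ℚ) : ℚ →* FiniteAdeleRing (𝓞 ℚ) ℚ)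
      (![-1, 1] i)) = ![-1, 1] := by
    funext i
    fin_cases i <;> simp
  rw [h]
  refine glDiagonal_mem_gammaOneFiniteLevel 𝔫 fun v => ?_
  rw [Units.val_neg, Units.val_one, show ((-1 : FiniteAdeleRing (𝓞 ℚ) ℚ) v) = -1 from rfl,
    Valuation.map_neg, Valuation.map_one]

/-- **`GL₂(𝔸_ℚ) = GL₂(ℚ) · (GL₂(ℝ)⁺ × K₁(𝔫))`** (Gelbart (1975), (3.1); Bump (1997), Thm. 3.3.1 and
§3.6): for every `g ∈ GL₂(𝔸_ℚ)` there is `γ ∈ GL₂(ℚ)` with `γ⁻¹ g ∈ GL₂(ℝ)⁺ × K₁(𝔫)`. Proof: strong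
approximation for the finite part (`Rat.exists_generalLinearGroup_map_mul_eq_of_gammaOneFiniteLevel`,
`g_f = γ₀ k`), then `γ = γ₀` or `γ = γ₀ ε` according to the sign of `det (γ₀⁻¹ g)_∞`.
[cite: Gelbart1975, (3.1)] [cite: Bump1997, Thm. 3.3.1] -/
theorem Rat.exists_ofGlobal_inv_mul_mem_plusLevelOne (𝔫 : Ideal (𝓞 ℚ))
    (g : GL (Fin 2) (AdeleRing (𝓞 ℚ) ℚ)) :
    ∃ γ : GL (Fin 2) ℚ, (GLn.ofGlobal 2 ℚ γ)⁻¹ * g ∈ Rat.plusLevelOne 𝔫 := by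
  obtain ⟨γ₀, k, hk, h⟩ := Rat.exists_generalLinearGroup_map_mul_eq_of_gammaOneFiniteLevel 𝔫 (GLn.sndHom 2 ℚ g)
  set h₀ : GL (Fin 2) (AdeleRing (𝓞 ℚ) ℚ) := (GLn.ofGlobal 2 ℚ γ₀)⁻¹ * g with hh₀
  have hf : GLn.sndHom 2 ℚ h₀ = k := by
    rw [hh₀, map_mul, map_inv, Rat.sndHom_ofGlobal, ← h, inv_mul_cancel_left]
  have hne : (Rat.archGL 2 h₀).det.val ≠ 0 := (Rat.archGL 2 h₀).det.ne_zero
  rcases lt_or_gt_of_ne hne with hneg | hpos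
  · refine ⟨γ₀ * Rat.signGL, ?_⟩
    have heq : (GLn.ofGlobal 2 ℚ (γ₀ * Rat.signGL))⁻¹ * g =
        (GLn.ofGlobal 2 ℚ Rat.signGL)⁻¹ * h₀ := by
      rw [map_mul, _root_.mul_inv_rev, hh₀, mul_assoc]
    rw [heq, Rat.mem_plusLevelOne_iff]
    constructor
    · rw [map_mul, map_inv, map_mul, map_inv, Units.val_mul, Units.val_inv_eq_inv_val,
        Rat.det_archGL_signGL, inv_neg, inv_one, neg_one_mul]
      exact neg_pos.2 hneg
    · rw [map_mul, map_inv, hf]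
      exact mul_mem (inv_mem (Rat.sndHom_signGL_mem 𝔫)) hk
  · refine ⟨γ₀, ?_⟩
    rw [← hh₀, Rat.mem_plusLevelOne_iff, hf]
    exact ⟨hpos, hk⟩

end PlusLevel

/-! ### `GL₂(ℚ) ∩ (GL₂(ℝ)⁺ × K₁(N)) = Γ₁(N)` -/

section Intersection

open IsDedekindDomain.HeightOneSpectrum

/-- A rational number which is integral at every finite place is an integer
(Mathlib `mem_integers_of_valuation_le_one` and `𝓞 ℚ = ℤ`). [folklore] -/
theorem Rat.exists_intCast_eq_of_valuation_le_one {q : ℚ}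
    (h : ∀ v : HeightOneSpectrum (𝓞 ℚ), v.valuation ℚ q ≤ 1) : ∃ z : ℤ, (z : ℚ) = q := by
  obtain ⟨x, hx⟩ := mem_integers_of_valuation_le_one ℚ q h
  refine ⟨Rat.ringOfIntegersEquiv x, ?_⟩
  rw [Rat.ringOfIntegersEquiv_apply_coe]
  exact hx

/-- At every finite place, the radius of the level ideal `(N) ⊆ 𝓞 ℚ` is `|N|_v`. [folklore] -/
theorem Rat.idealRadius_span_natCast (v : HeightOneSpectrum (𝓞 ℚ)) {N : ℕ} (hN : N ≠ 0) :
    idealRadius ℚ v (Ideal.span {(N : 𝓞 ℚ)}) = v.valuation ℚ (N : ℚ) := by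
  have hN' : (N : 𝓞 ℚ) ≠ 0 := by exact_mod_cast hN
  have hI : (Ideal.span {(N : 𝓞 ℚ)} : Ideal (𝓞 ℚ)) ≠ 0 := by
    rw [Ne, Ideal.zero_eq_bot, Ideal.span_singleton_eq_bot]
    exact hN'
  rw [idealRadius, FractionalIdeal.count_coe ℚ v hI, ← map_natCast (algebraMap (𝓞 ℚ) ℚ) N,
    valuation_of_algebraMap, intValuation_if_neg v hN']

/-- The finite-adelic image of `q ∈ ℚ` lies in the level ideal `N Ẑ` iff `|q|_v ≤ |N|_v` at
every finite place. [folklore] -/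
theorem Rat.algebraMap_mem_levelIdeal_iff {N : ℕ} (hN : N ≠ 0) (q : ℚ) :
    algebraMap ℚ (FiniteAdeleRing (𝓞 ℚ) ℚ) q ∈ levelIdeal ℚ (Ideal.span {(N : 𝓞 ℚ)}) ↔
      ∀ v : HeightOneSpectrum (𝓞 ℚ), v.valuation ℚ q ≤ v.valuation ℚ (N : ℚ) := by
  rw [mem_levelIdeal_iff]
  refine forall_congr' fun v => ?_
  rw [FiniteAdeleRing.algebraMap_apply, valuedAdicCompletion_eq_valuation', Rat.idealRadius_span_natCast v hN]

/-- A rational `q` with `|q|_v ≤ |N|_v` at every finite place is `N` times an integer. [folklore] -/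
theorem Rat.exists_eq_natCast_mul_of_valuation_le {N : ℕ} (hN : N ≠ 0) {q : ℚ}
    (h : ∀ v : HeightOneSpectrum (𝓞 ℚ), v.valuation ℚ q ≤ v.valuation ℚ (N : ℚ)) :
    ∃ z : ℤ, q = N * z := by
  have hN' : (N : ℚ) ≠ 0 := by exact_mod_cast hN
  obtain ⟨z, hz⟩ := Rat.exists_intCast_eq_of_valuation_le_one (q := q / N) fun v => by
    rw [map_div₀]
    have hv : v.valuation ℚ (N : ℚ) ≠ 0 := (Valuation.ne_zero_iff _).2 hN'
    exact (div_le_one₀ (zero_lt_iff.2 hv)).2 (h v)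
  exact ⟨z, by rw [hz, mul_div_cancel₀ q hN']⟩

/-- The finite-adelic image of `q ∈ ℚ` is integral iff `|q|_v ≤ 1` at every finite place. [folklore] -/
theorem Rat.algebraMap_mem_integralFiniteAdeles_iff (q : ℚ) :
    algebraMap ℚ (FiniteAdeleRing (𝓞 ℚ) ℚ) q ∈ integralFiniteAdeles ℚ ↔
      ∀ v : HeightOneSpectrum (𝓞 ℚ), v.valuation ℚ q ≤ 1 := by
  rw [mem_integralFiniteAdeles_iff]
  refine forall_congr' fun v => ?_
  rw [mem_adicCompletionIntegers, FiniteAdeleRing.algebraMap_apply, valuedAdicCompletion_eq_valuation']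

/-- A rational invertible matrix whose finite-adelic image and its inverse are integral comes
from `GL₂(ℤ)`: there is an integer matrix `A` with `A = γ` over `ℚ` and `det A = ±1`; if moreover
`det γ > 0` then `A ∈ SL₂(ℤ)`. Here: the `SL₂(ℤ)` statement. [folklore] -/
theorem Rat.exists_specialLinearGroup_eq_of_integral {γ : GL (Fin 2) ℚ}
    (h1 : ∀ i j, algebraMap ℚ (FiniteAdeleRing (𝓞 ℚ) ℚ) ((γ : Matrix (Fin 2) (Fin 2) ℚ) i j) ∈
      integralFiniteAdeles ℚ)
    (h2 : ∀ i j, algebraMap ℚ (FiniteAdeleRing (𝓞 ℚ) ℚ)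
      (((γ⁻¹ : GL (Fin 2) ℚ) : Matrix (Fin 2) (Fin 2) ℚ) i j) ∈ integralFiniteAdeles ℚ)
    (hdet : 0 < γ.det.val) :
    ∃ A : SL(2, ℤ), Matrix.SpecialLinearGroup.mapGL ℚ A = γ := by
  -- integer matrices `A`, `B` with `A = γ`, `B = γ⁻¹`
  have hA : ∀ i j, ∃ z : ℤ, (z : ℚ) = (γ : Matrix (Fin 2) (Fin 2) ℚ) i j := fun i j =>
    Rat.exists_intCast_eq_of_valuation_le_one ((Rat.algebraMap_mem_integralFiniteAdeles_iff _).1 (h1 i j))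
  have hB : ∀ i j, ∃ z : ℤ, (z : ℚ) = ((γ⁻¹ : GL (Fin 2) ℚ) : Matrix (Fin 2) (Fin 2) ℚ) i j := fun i j =>
    Rat.exists_intCast_eq_of_valuation_le_one ((Rat.algebraMap_mem_integralFiniteAdeles_iff _).1 (h2 i j))
  choose A hA using hA
  choose B hB using hB
  have hA' : (Matrix.of A).map (Int.castRingHom ℚ) = (γ : Matrix (Fin 2) (Fin 2) ℚ) := by
    ext i j; exact hA i j
  have hB' : (Matrix.of B).map (Int.castRingHom ℚ) = ((γ⁻¹ : GL (Fin 2) ℚ) : Matrix (Fin 2) (Fin 2) ℚ) := by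
    ext i j; exact hB i j
  have hAB : Matrix.of A * Matrix.of B = 1 := by
    apply Matrix.map_injective (f := Int.castRingHom ℚ) Int.cast_injective
    change (Matrix.of A * Matrix.of B).map (Int.castRingHom ℚ) = (1 : Matrix (Fin 2) (Fin 2) ℤ).map (Int.castRingHom ℚ)
    rw [Matrix.map_mul, hA', hB', Matrix.map_one (Int.castRingHom ℚ) (map_zero _) (map_one _),
      ← Units.val_mul, mul_inv_cancel, Units.val_one]
  have hdetA : (Matrix.of A).det = 1 := by
    have hu : (Matrix.of A).det * (Matrix.of B).det = 1 := by rw [← Matrix.det_mul, hAB, Matrix.det_one]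
    rcases Int.eq_one_or_neg_one_of_mul_eq_one hu with h | h
    · exact h
    · exfalso
      have hcast : ((Matrix.of A).det : ℚ) = γ.det.val := by
        rw [Matrix.GeneralLinearGroup.val_det_apply, ← hA', ← RingHom.mapMatrix_apply, ← RingHom.map_det]
        rfl
      rw [h] at hcast
      have : (γ.det.val : ℚ) = -1 := by rw [← hcast]; push_cast; ring
      linarith
  refine ⟨⟨Matrix.of A, hdetA⟩, ?_⟩
  ext i j
  change ((A i j : ℤ) : ℚ) = (γ : Matrix (Fin 2) (Fin 2) ℚ) i j
  exact hA i j

/-- **`GL₂(ℚ) ∩ (GL₂(ℝ)⁺ × K₁(N)) = Γ₁(N)`** (Gelbart (1975), (3.5), there for `K₀(N)`/`Γ₀(N)`;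
Bump (1997), §3.6; Diamond–Im §11.1): a rational matrix `γ` whose adelic image lies in
`GL₂(ℝ)⁺ × K₁(N)` is (the image of) an element of `Γ₁(N) ≤ SL₂(ℤ)`. Integrality of `γ^{±1}` at all
`p` makes `γ ∈ GL₂(ℤ)`, positivity of `det γ` makes `det γ = 1`, and the `K₁(N)` congruences
`c ∈ NẐ`, `d - 1 ∈ NẐ` read `c ≡ 0`, `d ≡ 1 (mod N)`, whence `a ≡ ad - bc = 1`. [cite: Gelbart1975, (3.5)] -/
theorem Rat.exists_gamma1_of_ofGlobal_mem_plusLevelOne {N : ℕ} [NeZero N] {γ : GL (Fin 2) ℚ}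
    (h : GLn.ofGlobal 2 ℚ γ ∈ Rat.plusLevelOne (Ideal.span {(N : 𝓞 ℚ)})) :
    ∃ A : SL(2, ℤ), A ∈ CongruenceSubgroup.Gamma1 N ∧ Matrix.SpecialLinearGroup.mapGL ℚ A = γ := by
  have hN : N ≠ 0 := NeZero.ne N
  rw [Rat.mem_plusLevelOne_iff, Rat.archGL_ofGlobal, Rat.sndHom_ofGlobal, mem_gammaOneFiniteLevel_iff,
    mem_gammaZeroFiniteLevel_iff, mem_eichlerOrder_iff, mem_eichlerOrder_iff, ← map_inv] at h
  obtain ⟨hdet, ⟨⟨hint, hc⟩, hint', -⟩, hd⟩ := h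
  have hdet' : 0 < γ.det.val := by
    rw [Matrix.GeneralLinearGroup.map_det, Units.coe_map, MonoidHom.coe_coe, Rat.coe_castHom] at hdet
    exact_mod_cast hdet
  obtain ⟨A, rfl⟩ := Rat.exists_specialLinearGroup_eq_of_integral
    (fun i j => by simpa only [Matrix.GeneralLinearGroup.map_apply] using hint i j)
    (fun i j => by simpa only [Matrix.GeneralLinearGroup.map_apply] using hint' i j) hdet'
  refine ⟨A, ?_, rfl⟩
  -- the congruences
  have hentry : ∀ i j, ((Matrix.SpecialLinearGroup.mapGL ℚ A : GL (Fin 2) ℚ) : Matrix (Fin 2) (Fin 2) ℚ) i j =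
      ((A : Matrix (Fin 2) (Fin 2) ℤ) i j : ℚ) := fun i j => rfl
  rw [Matrix.GeneralLinearGroup.map_apply, hentry, Rat.algebraMap_mem_levelIdeal_iff hN] at hc
  have e11 : algebraMap ℚ (FiniteAdeleRing (𝓞 ℚ) ℚ) (((A : Matrix (Fin 2) (Fin 2) ℤ) 1 1 : ℤ) : ℚ) - 1 =
      algebraMap ℚ (FiniteAdeleRing (𝓞 ℚ) ℚ) (((A : Matrix (Fin 2) (Fin 2) ℤ) 1 1 - 1 : ℤ) : ℚ) := by
    rw [Int.cast_sub, Int.cast_one, map_sub, map_one]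
  rw [Matrix.GeneralLinearGroup.map_apply, hentry, e11, Rat.algebraMap_mem_levelIdeal_iff hN] at hd
  obtain ⟨m, hm⟩ := Rat.exists_eq_natCast_mul_of_valuation_le hN hc
  obtain ⟨m', hm'⟩ := Rat.exists_eq_natCast_mul_of_valuation_le hN hd
  have hc' : (A : Matrix (Fin 2) (Fin 2) ℤ) 1 0 = N * m := by exact_mod_cast hm
  have hd' : (A : Matrix (Fin 2) (Fin 2) ℤ) 1 1 - 1 = N * m' := by exact_mod_cast hm'
  have hdetA := Matrix.det_fin_two (A : Matrix (Fin 2) (Fin 2) ℤ)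
  rw [A.det_coe] at hdetA
  rw [CongruenceSubgroup.Gamma1_mem]
  have e10 : (((A : Matrix (Fin 2) (Fin 2) ℤ) 1 0 : ℤ) : ZMod N) = 0 := by
    rw [hc']; push_cast; simp
  have e11 : (((A : Matrix (Fin 2) (Fin 2) ℤ) 1 1 : ℤ) : ZMod N) = 1 := by
    have : (A : Matrix (Fin 2) (Fin 2) ℤ) 1 1 = N * m' + 1 := by omega
    rw [this]; push_cast; simp
  refine ⟨?_, e11, e10⟩
  have h00 := congrArg (fun z : ℤ => (z : ZMod N)) hdetA
  simp only [Int.cast_one, Int.cast_sub, Int.cast_mul] at h00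
  rw [e10, e11, mul_zero, sub_zero, mul_one] at h00
  exact h00.symm

/-- The converse inclusion **`Γ₁(N) ⊆ GL₂(ℝ)⁺ × K₁(N)`**: the adelic image of `A ∈ Γ₁(N)` has
archimedean determinant `1 > 0`, integral finite part with integral inverse, `c ∈ NẐ` and
`d - 1 ∈ NẐ` (Gelbart (1975), (3.5)). [cite: Gelbart1975, (3.5)] -/
theorem Rat.ofGlobal_mapGL_mem_plusLevelOne {N : ℕ} [NeZero N] {A : SL(2, ℤ)}
    (hA : A ∈ CongruenceSubgroup.Gamma1 N) :
    GLn.ofGlobal 2 ℚ (Matrix.SpecialLinearGroup.mapGL ℚ A) ∈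
      Rat.plusLevelOne (Ideal.span {(N : 𝓞 ℚ)}) := by
  have hN : N ≠ 0 := NeZero.ne N
  rw [CongruenceSubgroup.Gamma1_mem] at hA
  obtain ⟨-, h11, h10⟩ := hA
  have hentry : ∀ (B : SL(2, ℤ)) i j,
      ((Matrix.SpecialLinearGroup.mapGL ℚ B : GL (Fin 2) ℚ) : Matrix (Fin 2) (Fin 2) ℚ) i j =
        ((B : Matrix (Fin 2) (Fin 2) ℤ) i j : ℚ) := fun B i j => rfl
  -- integrality of an integer matrix
  have hintB : ∀ (B : SL(2, ℤ)) i j, algebraMap ℚ (FiniteAdeleRing (𝓞 ℚ) ℚ)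
      (((Matrix.SpecialLinearGroup.mapGL ℚ B : GL (Fin 2) ℚ) : Matrix (Fin 2) (Fin 2) ℚ) i j) ∈
        integralFiniteAdeles ℚ := fun B i j => by
    rw [hentry, Rat.algebraMap_mem_integralFiniteAdeles_iff]
    intro v
    rw [← map_intCast (algebraMap (𝓞 ℚ) ℚ), valuation_of_algebraMap]
    exact intValuation_le_one v _
  -- valuations of integer multiples of `N`
  have hmul : ∀ z : ℤ, ∀ v : HeightOneSpectrum (𝓞 ℚ),
      v.valuation ℚ ((N : ℚ) * z) ≤ v.valuation ℚ (N : ℚ) := fun z v => by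
    rw [Valuation.map_mul]
    have hz : v.valuation ℚ (z : ℚ) ≤ 1 := by
      rw [← map_intCast (algebraMap (𝓞 ℚ) ℚ), valuation_of_algebraMap]
      exact intValuation_le_one v _
    exact mul_le_of_le_one_right zero_le hz
  have hdvd : ∀ {z : ℤ}, (N : ℤ) ∣ z → ∀ v : HeightOneSpectrum (𝓞 ℚ),
      v.valuation ℚ (z : ℚ) ≤ v.valuation ℚ (N : ℚ) := fun ⟨m, hm⟩ v => by
    rw [hm, Int.cast_mul, Int.cast_natCast]
    exact hmul m v
  have hinv10 : ((A⁻¹ : SL(2, ℤ)) : Matrix (Fin 2) (Fin 2) ℤ) 1 0 = -(A : Matrix (Fin 2) (Fin 2) ℤ) 1 0 := by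
    rw [Matrix.SpecialLinearGroup.coe_inv, Matrix.adjugate_fin_two]
    simp
  rw [Rat.mem_plusLevelOne_iff, Rat.archGL_ofGlobal, Rat.sndHom_ofGlobal, mem_gammaOneFiniteLevel_iff,
    mem_gammaZeroFiniteLevel_iff, mem_eichlerOrder_iff, mem_eichlerOrder_iff, ← map_inv, ← map_inv]
  refine ⟨?_, ⟨⟨fun i j => ?_, ?_⟩, fun i j => ?_, ?_⟩, ?_⟩
  · rw [Matrix.GeneralLinearGroup.map_det, Units.coe_map, MonoidHom.coe_coe, Rat.coe_castHom]
    have : ((Matrix.SpecialLinearGroup.mapGL ℚ A : GL (Fin 2) ℚ).det.val : ℚ) = 1 := by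
      rw [Matrix.GeneralLinearGroup.val_det_apply]
      change ((A : Matrix (Fin 2) (Fin 2) ℤ).map (Int.castRingHom ℚ)).det = 1
      rw [← RingHom.mapMatrix_apply, ← RingHom.map_det, A.det_coe, map_one]
    rw [this]; norm_num
  · rw [Matrix.GeneralLinearGroup.map_apply]; exact hintB A i j
  · rw [Matrix.GeneralLinearGroup.map_apply, hentry, Rat.algebraMap_mem_levelIdeal_iff hN]
    exact hdvd ((ZMod.intCast_zmod_eq_zero_iff_dvd _ N).1 h10)
  · rw [Matrix.GeneralLinearGroup.map_apply]; exact hintB A⁻¹ i j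
  · rw [Matrix.GeneralLinearGroup.map_apply, hentry, Rat.algebraMap_mem_levelIdeal_iff hN, hinv10,
      Int.cast_neg]
    intro v
    rw [Valuation.map_neg]
    exact hdvd ((ZMod.intCast_zmod_eq_zero_iff_dvd _ N).1 h10) v
  · have e : algebraMap ℚ (FiniteAdeleRing (𝓞 ℚ) ℚ) (((A : Matrix (Fin 2) (Fin 2) ℤ) 1 1 : ℤ) : ℚ) - 1 =
        algebraMap ℚ (FiniteAdeleRing (𝓞 ℚ) ℚ) (((A : Matrix (Fin 2) (Fin 2) ℤ) 1 1 - 1 : ℤ) : ℚ) := by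
      rw [Int.cast_sub, Int.cast_one, map_sub, map_one]
    rw [Matrix.GeneralLinearGroup.map_apply, hentry, e, Rat.algebraMap_mem_levelIdeal_iff hN]
    refine hdvd ((ZMod.intCast_eq_intCast_iff_dvd_sub 1 _ N).1 ?_)
    rw [Int.cast_one]
    exact h11.symm

/-- **`GL₂(ℚ) ∩ (GL₂(ℝ)⁺ × K₁(N)) = Γ₁(N)`**, iff form of the two inclusions
(`Rat.exists_gamma1_of_ofGlobal_mem_plusLevelOne`, `Rat.ofGlobal_mapGL_mem_plusLevelOne`). [cite: Gelbart1975, (3.5)] -/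
theorem Rat.ofGlobal_mem_plusLevelOne_iff {N : ℕ} [NeZero N] {γ : GL (Fin 2) ℚ} :
    GLn.ofGlobal 2 ℚ γ ∈ Rat.plusLevelOne (Ideal.span {(N : 𝓞 ℚ)}) ↔
      ∃ A : SL(2, ℤ), A ∈ CongruenceSubgroup.Gamma1 N ∧ Matrix.SpecialLinearGroup.mapGL ℚ A = γ := by
  refine ⟨Rat.exists_gamma1_of_ofGlobal_mem_plusLevelOne, ?_⟩
  rintro ⟨A, hA, rfl⟩
  exact Rat.ofGlobal_mapGL_mem_plusLevelOne hA

/-- The real image of `mapGL ℚ A`, `A ∈ SL₂(ℤ)`, is `mapGL ℝ A` (so that membership in the level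
`(Γ₁(N) : Subgroup (GL (Fin 2) ℝ)) = map (mapGL ℝ) (Gamma1 N)` of Mathlib's modular forms can be
read off). [folklore] -/
theorem Rat.map_castHom_mapGL (A : SL(2, ℤ)) :
    Matrix.GeneralLinearGroup.map (Rat.castHom ℝ) (Matrix.SpecialLinearGroup.mapGL ℚ A) =
      Matrix.SpecialLinearGroup.mapGL ℝ A := by
  ext i j
  rw [Matrix.GeneralLinearGroup.map_apply]
  change (Rat.castHom ℝ) (((A : Matrix (Fin 2) (Fin 2) ℤ) i j : ℚ)) = ((A : Matrix (Fin 2) (Fin 2) ℤ) i j : ℝ)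
  rw [Rat.coe_castHom, Rat.cast_intCast]

/-- The archimedean part of a rational `γ` whose adelic image lies in `GL₂(ℝ)⁺ × K₁(N)` lies in
the arithmetic subgroup `Γ₁(N) ≤ GL₂(ℝ)` of Mathlib's modular form theory. [cite: Gelbart1975, (3.5)] -/
theorem Rat.archGL_ofGlobal_mem_gamma1 {N : ℕ} [NeZero N] {γ : GL (Fin 2) ℚ}
    (h : GLn.ofGlobal 2 ℚ γ ∈ Rat.plusLevelOne (Ideal.span {(N : 𝓞 ℚ)})) :
    Rat.archGL 2 (GLn.ofGlobal 2 ℚ γ) ∈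
      ((CongruenceSubgroup.Gamma1 N : Subgroup SL(2, ℤ)) : Subgroup (GL (Fin 2) ℝ)) := by
  obtain ⟨A, hA, rfl⟩ := Rat.exists_gamma1_of_ofGlobal_mem_plusLevelOne h
  rw [Rat.archGL_ofGlobal, Rat.map_castHom_mapGL]
  exact Subgroup.mem_map_of_mem _ hA

end Intersection

/-! ### `GL_n(ℝ) ⊆ GL_n(𝔸_ℚ)`, the centre `A_G` and the level `K(𝔫)` -/

section ArchEmbedding

variable (n : ℕ) (K : Type) [Field K] [NumberField K]

/-- The embedding `GL_n(K_∞) →* GL_n(𝔸_K) = GL_n(K_∞ × 𝔸_K^∞)`, `h ↦ (h, 1)`: on matrices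
`h ↦ 1 + ι (h - 1)` for the (non-unital) factor inclusion `ι = infiniteAdeleInl K : K_∞ → 𝔸_K` of
`AdelicGLnGlue` (`oneAddHom`, as for `GLn.ofFinite`), then `Units.map`. This is the `GL_n(K_∞)`-form
of `GLn.ofInfinite` of `AdelicGLnGlue` (which starts from `GL_n(mixedSpace K)`):
`GLn.ofInfinite n K = (GLn.ofArch n K) ∘ infiniteEquivMixed.symm` (`GLn.ofInfinite_eq_ofArch_comp`,
definitional); it is the variant needed to embed `GL_n(ℝ) = GL_n(ℚ_∞)` without passing through the
mixed space (Gelbart (1975), §3.A: `G_∞ ⊆ G_𝔸`). [folklore] -/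
def GLn.ofArch : GL (Fin n) (InfiniteAdeleRing K) →* GL (Fin n) (AdeleRing (𝓞 K) K) :=
  Units.map (oneAddHom ((infiniteAdeleInl K).mapMatrix (Fin n)))

/-- Compatibility with `AdelicGLnGlue`: `GLn.ofInfinite = GLn.ofArch ∘ infiniteEquivMixed⁻¹`
(definitional). [folklore] -/
theorem GLn.ofInfinite_eq_ofArch_comp :
    GLn.ofInfinite n K = (GLn.ofArch n K).comp (GLn.infiniteEquivMixed n K).symm.toMonoidHom :=
  rfl

variable {n K} in
/-- Compatibility with `AdelicGLnGlue`, pointwise: `GLn.ofArch h = GLn.ofInfinite (infiniteEquivMixed h)`. [folklore] -/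
theorem GLn.ofArch_eq_ofInfinite (h : GL (Fin n) (InfiniteAdeleRing K)) :
    GLn.ofArch n K h = GLn.ofInfinite n K (GLn.infiniteEquivMixed n K h) := by
  rw [GLn.ofInfinite_eq_ofArch_comp, MonoidHom.comp_apply, MulEquiv.coe_toMonoidHom,
    MulEquiv.symm_apply_apply]

variable {n K} in
/-- Entries of `GLn.ofArch h` are `(h_{ij}, δ_{ij})`. [folklore] -/
theorem GLn.coe_ofArch_apply (h : GL (Fin n) (InfiniteAdeleRing K)) (i j : Fin n) :
    (GLn.ofArch n K h : Matrix (Fin n) (Fin n) (AdeleRing (𝓞 K) K)) i j =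
      ((h : Matrix (Fin n) (Fin n) (InfiniteAdeleRing K)) i j,
        (1 : Matrix (Fin n) (Fin n) (FiniteAdeleRing (𝓞 K) K)) i j) := by
  refine Prod.ext ?_ ?_
  · change ((1 : Matrix (Fin n) (Fin n) (AdeleRing (𝓞 K) K)) i j).1 +
      ((h : Matrix (Fin n) (Fin n) (InfiniteAdeleRing K)) i j -
        (1 : Matrix (Fin n) (Fin n) (InfiniteAdeleRing K)) i j) = _
    rw [Matrix.one_apply, Matrix.one_apply]
    split_ifs
    · change (1 : InfiniteAdeleRing K) + _ = _
      rw [add_sub_cancel]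
    · change (0 : InfiniteAdeleRing K) + _ = _
      rw [zero_add, sub_zero]
  · change ((1 : Matrix (Fin n) (Fin n) (AdeleRing (𝓞 K) K)) i j).2 + 0 = _
    rw [add_zero, Matrix.one_apply, Matrix.one_apply]
    split_ifs <;> rfl

variable {n K} in
/-- `GLn.ofArch` is a section of the projection to the archimedean part. [folklore] -/
@[simp]
theorem GLn.fstHom_ofArch (h : GL (Fin n) (InfiniteAdeleRing K)) :
    GLn.fstHom n K (GLn.ofArch n K h) = h :=
  Matrix.GeneralLinearGroup.ext fun i j => by
    change ((GLn.ofArch n K h : Matrix (Fin n) (Fin n) (AdeleRing (𝓞 K) K)) i j).1 = _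
    rw [GLn.coe_ofArch_apply]

variable {n K} in
/-- The finite part of `GLn.ofArch h` is `1`. [folklore] -/
@[simp]
theorem GLn.sndHom_ofArch (h : GL (Fin n) (InfiniteAdeleRing K)) :
    GLn.sndHom n K (GLn.ofArch n K h) = 1 :=
  Matrix.GeneralLinearGroup.ext fun i j => by
    change ((GLn.ofArch n K h : Matrix (Fin n) (Fin n) (AdeleRing (𝓞 K) K)) i j).2 = _
    rw [GLn.coe_ofArch_apply, Units.val_one]

/-- The embedding **`GL_n(ℝ) →* GL_n(𝔸_ℚ)`**, `g_∞ ↦ (g_∞, 1)` (`ℝ = 𝔸_{ℚ,∞}` by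
`Rat.infiniteAdeleRingEquivReal`; Gelbart (1975), §3.A, `G_∞ ⊆ G_𝔸`). [folklore] -/
def Rat.ofRealGL (n : ℕ) : GL (Fin n) ℝ →* GL (Fin n) (AdeleRing (𝓞 ℚ) ℚ) :=
  (GLn.ofArch n ℚ).comp (Matrix.GeneralLinearGroup.map Rat.infiniteAdeleRingEquivReal.symm.toRingHom)

/-- `(g_∞, 1)_∞ = g_∞`. [folklore] -/
@[simp]
theorem Rat.archGL_ofRealGL (n : ℕ) (g : GL (Fin n) ℝ) : Rat.archGL n (Rat.ofRealGL n g) = g := by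
  ext i j
  rw [Rat.archGL_apply, Rat.ofRealGL, MonoidHom.comp_apply, GLn.coe_ofArch_apply,
    Matrix.GeneralLinearGroup.map_apply]
  exact Rat.infiniteAdeleRingEquivReal.apply_symm_apply _

/-- `(g_∞, 1)` has trivial finite part. [folklore] -/
@[simp]
theorem Rat.sndHom_ofRealGL (n : ℕ) (g : GL (Fin n) ℝ) : GLn.sndHom n ℚ (Rat.ofRealGL n g) = 1 := by
  rw [Rat.ofRealGL, MonoidHom.comp_apply, GLn.sndHom_ofArch]

/-- `(g_∞, 1) ∈ GL₂(ℝ)⁺ × K₁(𝔫)` iff `det g_∞ > 0`. [folklore] -/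
theorem Rat.ofRealGL_mem_plusLevelOne_iff {𝔫 : Ideal (𝓞 ℚ)} {g : GL (Fin 2) ℝ} :
    Rat.ofRealGL 2 g ∈ Rat.plusLevelOne 𝔫 ↔ 0 < g.det.val := by
  rw [Rat.mem_plusLevelOne_iff, Rat.archGL_ofRealGL, Rat.sndHom_ofRealGL]
  exact ⟨fun h => h.1, fun h => ⟨h, one_mem _⟩⟩

end ArchEmbedding

section CenterLevel

/-- The archimedean part of the central element `posRealScalar 2 ℚ t ∈ A_G` is the positive real
scalar matrix `realScalarGL t`. [folklore] -/
theorem Rat.archGL_posRealScalar_two (t : ℝ≥0ˣ) :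
    Rat.archGL 2 (posRealScalar 2 ℚ t) =
      realScalarGL ((t : ℝ≥0) : ℝ) (NNReal.coe_pos.2 (pos_iff_ne_zero.2 t.ne_zero)) := by
  ext i j
  rw [Rat.archGL_posRealScalar, realScalarGL_apply]

/-- The central elements `posRealScalar 2 ℚ t ∈ A_G` lie in `GL₂(ℝ)⁺ × K₁(𝔫)`. [folklore] -/
theorem Rat.posRealScalar_mem_plusLevelOne (𝔫 : Ideal (𝓞 ℚ)) (t : ℝ≥0ˣ) :
    posRealScalar 2 ℚ t ∈ Rat.plusLevelOne 𝔫 := by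
  rw [Rat.mem_plusLevelOne_iff, Rat.archGL_posRealScalar_two, det_realScalarGL, Rat.sndHom_posRealScalar]
  exact ⟨pow_pos (NNReal.coe_pos.2 (pos_iff_ne_zero.2 t.ne_zero)) 2, one_mem _⟩

/-- An element of the integral level `K^max` has trivial archimedean part. [folklore] -/
theorem Rat.archGL_eq_one_of_mem_glIntegralLevel {n : ℕ} {u : GL (Fin n) (AdeleRing (𝓞 ℚ) ℚ)}
    (hu : u ∈ glIntegralLevel n ℚ) : Rat.archGL n u = 1 := by
  rw [Rat.archGL, MonoidHom.comp_apply, (mem_glIntegralLevel_iff.1 hu).2, map_one]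

/-- **`K(𝔫) ⊆ {1} × K₁(𝔫)`**: the finite part of an element of the principal congruence subgroup
`K(𝔫)` (`principalCongruenceLevel 2 ℚ 𝔫`) lies in `K₁(𝔫)` — its entries and those of its
inverse are integral, and `u ≡ 1 (mod 𝔫)` entrywise gives `c ∈ 𝔫𝒪̂`, `d - 1 ∈ 𝔫𝒪̂`
(Gelbart (1975), §3.A; Bump (1997), §3.3). [folklore] -/
theorem Rat.sndHom_mem_gammaOneFiniteLevel_of_mem_principalCongruenceLevel {𝔫 : Ideal (𝓞 ℚ)}
    {u : GL (Fin 2) (AdeleRing (𝓞 ℚ) ℚ)} (hu : u ∈ principalCongruenceLevel 2 ℚ 𝔫) :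
    GLn.sndHom 2 ℚ u ∈ gammaOneFiniteLevel ℚ 𝔫 := by
  have hu' : u⁻¹ ∈ principalCongruenceLevel 2 ℚ 𝔫 := inv_mem hu
  rw [mem_principalCongruenceLevel_iff] at hu hu'
  obtain ⟨hint, hloc⟩ := hu
  obtain ⟨hint', hloc'⟩ := hu'
  rw [mem_glIntegralLevel_iff, mem_glFiniteIntegralLevel_iff] at hint hint'
  -- the local congruence conditions, read on the finite parts of the entries
  have key : ∀ {w : GL (Fin 2) (AdeleRing (𝓞 ℚ) ℚ)},
      (∀ v, (AdelicGroupData.gl 2 ℚ).toLocal v w ∈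
        valuedCongruenceSubgroup (Fin 2) (idealRadius ℚ v 𝔫)) →
      ∀ i j, (GLn.sndHom 2 ℚ w : Matrix (Fin 2) (Fin 2) (FiniteAdeleRing (𝓞 ℚ) ℚ)) i j -
        (1 : Matrix (Fin 2) (Fin 2) (FiniteAdeleRing (𝓞 ℚ) ℚ)) i j ∈ levelIdeal ℚ 𝔫 := by
    intro w hw i j
    rw [mem_levelIdeal_iff]
    intro v
    have h3 : Valued.v ((((w : Matrix (Fin 2) (Fin 2) (AdeleRing (𝓞 ℚ) ℚ)) i j).2 v) -
        (1 : Matrix (Fin 2) (Fin 2) (v.adicCompletion ℚ)) i j) ≤ idealRadius ℚ v 𝔫 :=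
      (mem_valuedCongruenceSubgroup_iff.1 (hw v)).2.2 i j
    have e : ((GLn.sndHom 2 ℚ w : Matrix (Fin 2) (Fin 2) (FiniteAdeleRing (𝓞 ℚ) ℚ)) i j -
        (1 : Matrix (Fin 2) (Fin 2) (FiniteAdeleRing (𝓞 ℚ) ℚ)) i j) v =
        (((w : Matrix (Fin 2) (Fin 2) (AdeleRing (𝓞 ℚ) ℚ)) i j).2 v) -
          (1 : Matrix (Fin 2) (Fin 2) (v.adicCompletion ℚ)) i j := by
      rw [Matrix.one_apply, Matrix.one_apply]
      split_ifs <;> rfl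
    rw [e]
    exact h3
  have hk := key hloc
  have hk' := key hloc'
  rw [mem_gammaOneFiniteLevel_iff, mem_gammaZeroFiniteLevel_iff, mem_eichlerOrder_iff, mem_eichlerOrder_iff]
  refine ⟨⟨⟨hint.1.1, ?_⟩, ?_, ?_⟩, ?_⟩
  · have h := hk 1 0
    rwa [Matrix.one_apply_ne (by decide), sub_zero] at h
  · rw [← map_inv]; exact hint'.1.1
  · rw [← map_inv]
    have h := hk' 1 0
    rwa [Matrix.one_apply_ne (by decide), sub_zero] at h
  · have h := hk 1 1
    rwa [Matrix.one_apply_eq] at h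

/-- `K(𝔫) ≤ GL₂(ℝ)⁺ × K₁(𝔫)`. [folklore] -/
theorem Rat.principalCongruenceLevel_le_plusLevelOne (𝔫 : Ideal (𝓞 ℚ)) :
    principalCongruenceLevel 2 ℚ 𝔫 ≤ Rat.plusLevelOne 𝔫 := fun u hu => by
  rw [Rat.mem_plusLevelOne_iff, Rat.archGL_eq_one_of_mem_glIntegralLevel (principalCongruenceLevel_le 2 ℚ 𝔫 hu),
    map_one, Units.val_one]
  exact ⟨one_pos, Rat.sndHom_mem_gammaOneFiniteLevel_of_mem_principalCongruenceLevel hu⟩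

end CenterLevel

end Literature.NumberTheory.Automorphic
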